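import Summits.AnomalousDissipation.AnomalousDissipation.Theorems.SolenoidalFractalHomogenisationLagrangianStepSidebandResponseExt
import Mathlib.Topology.Instances.AddCircle.Defs
import HarnessLib

/-!
# K1L_D `LagrangianRenormalisationStepDesign` (stmt-AnomalousDissipation-27980), `stub_D1_V0` (V0 = clause (ii) of
# `WCrossing.D1ExactFamily`), brick T4c-0 (cont.): THE PERIODIC EXTENSION OF THE REFERENCE RESPONSE IS CONTINUOUS
# (helper; `--kind proof --supports stmt-AnomalousDissipation-27980 --as helper`)

Summits-side helper file of route `SolenoidalFractalHomogenisation` (prover seat `ad-k1l-cellLawV-w1` g6).  Everything proved; no definitions, no named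
facts, no sorry.  `…SidebandResponseExt.responseExt t = response (toIcoMod P 0 t)`; `toIcoMod` is only right-continuous, but at the junctions the periodic
response closes up (`response P = response 0`), so `responseExt = response ∘ toIocMod P 0` as well (`responseExt_eq_response_toIocMod`), which is
left-continuous; hence **`continuous_responseExt`** — the continuity on `[0,T]` of the reference (and so of the residual energy `‖r‖²`) that Grönwall from the
right (`…RightGronwall.le_exp_of_deriv_right_le`) consumes.
NOT a proof of any registered stub, of K1L_D, or of anomalous dissipation; rung F-D1.A0 infrastructure.
-/

set_option linter.dupNamespace false

noncomputable section

namespace Summit.AnomalousDissipation.AnomalousDissipation.Theorems.SolenoidalFractalHomogenisation.LagrangianStep.Sideband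

open Set MeasureTheory Complex UnitAddTorus Filter Topology
open scoped InnerProductSpace
open Literature.Analysis Literature.Analysis.FunctionSpaces Literature.Analysis.FunctionSpaces.Torus
open Literature.Analysis.FluidPDE Literature.Analysis.FluidPDE.Torus Literature.Analysis.FluidPDE.LatticeShear
open Summit.AnomalousDissipation.AnomalousDissipation.Theorems.SolenoidalFractalHomogenisation.PermissibleCarrier (period_pos)

variable {k₀ : ℕ}

/-- **At the junctions the two reductions agree through the response**: `responseExt t = response (toIocMod P 0 t)` (the response closes up,
`response P = response 0`). [cite: SandersVerhulstMurdock2007, Lemma 5.2.7 (linear case)] -/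
theorem responseExt_eq_response_toIocMod (W₁ : LatticeWord k₀) (𝔸 : Torus.Visc4 (Fin 3)) (γ₁ : ℝ) (R : ℕ) (j : Fin k₀)
    (hN : IsPeriodicResponse W₁ 𝔸 γ₁ R j (response W₁ 𝔸 γ₁ R j)) (t : ℝ) :
    responseExt W₁ 𝔸 γ₁ R j t = response W₁ 𝔸 γ₁ R j (toIocMod (period_pos W₁) 0 t) := by
  rw [responseExt_def]
  by_cases h : (0 : ℝ) ≡ t [PMOD W₁.period]
  · rw [(AddCommGroup.modEq_iff_toIcoMod_eq_left (period_pos W₁)).1 h, (AddCommGroup.modEq_iff_toIocMod_eq_right (period_pos W₁)).1 h, zero_add]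
    exact hN.2.2.symm
  · rw [(AddCommGroup.not_modEq_iff_toIcoMod_eq_toIocMod (period_pos W₁)).1 h]

/-- **The periodic extension of the reference response is continuous.** [cite: SandersVerhulstMurdock2007, Lemma 5.2.7 (linear case)] -/
theorem continuous_responseExt (W₁ : LatticeWord k₀) (𝔸 : Torus.Visc4 (Fin 3)) (γ₁ : ℝ) (R : ℕ) (j : Fin k₀)
    (hN : IsPeriodicResponse W₁ 𝔸 γ₁ R j (response W₁ 𝔸 γ₁ R j)) : Continuous (responseExt W₁ 𝔸 γ₁ R j) := by
  have hP := period_pos W₁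
  have hc : ContinuousOn (response W₁ 𝔸 γ₁ R j) (Icc 0 W₁.period) := hN.1
  rw [continuous_iff_continuousAt]
  intro t
  rw [continuousAt_iff_continuous_left_right]
  constructor
  · -- from the left through `toIocMod`
    have hfun : responseExt W₁ 𝔸 γ₁ R j = fun τ => response W₁ 𝔸 γ₁ R j (toIocMod hP 0 τ) :=
      funext (responseExt_eq_response_toIocMod W₁ 𝔸 γ₁ R j hN)
    rw [hfun]
    have hmem : toIocMod hP 0 t ∈ Icc 0 W₁.period := by
      have := toIocMod_mem_Ioc hP 0 t; rw [zero_add] at this; exact Ioc_subset_Icc_self this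
    refine ContinuousWithinAt.comp (hc _ hmem) (continuousWithinAt_toIocMod_Iic hP 0 t) ?_
    intro τ _
    have := toIocMod_mem_Ioc hP 0 τ; rw [zero_add] at this; exact Ioc_subset_Icc_self this
  · -- from the right through `toIcoMod`
    have hfun : responseExt W₁ 𝔸 γ₁ R j = fun τ => response W₁ 𝔸 γ₁ R j (toIcoMod hP 0 τ) := funext fun τ => responseExt_def W₁ 𝔸 γ₁ R j τ
    rw [hfun]
    have hmem : toIcoMod hP 0 t ∈ Icc 0 W₁.period := Ico_subset_Icc_self (by simpa using toIcoMod_mem_Ico' hP t)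
    refine ContinuousWithinAt.comp (hc _ hmem) (continuousWithinAt_toIcoMod_Ici hP 0 t) ?_
    intro τ _
    exact Ico_subset_Icc_self (by simpa using toIcoMod_mem_Ico' hP τ)

/-- Continuity on any set (the form `ContinuousOn` arguments consume). [cite: SandersVerhulstMurdock2007, Lemma 5.2.7 (linear case)] -/
theorem continuousOn_responseExt (W₁ : LatticeWord k₀) (𝔸 : Torus.Visc4 (Fin 3)) (γ₁ : ℝ) (R : ℕ) (j : Fin k₀)
    (hN : IsPeriodicResponse W₁ 𝔸 γ₁ R j (response W₁ 𝔸 γ₁ R j)) (s : Set ℝ) : ContinuousOn (responseExt W₁ 𝔸 γ₁ R j) s :=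
  (continuous_responseExt W₁ 𝔸 γ₁ R j hN).continuousOn

end Summit.AnomalousDissipation.AnomalousDissipation.Theorems.SolenoidalFractalHomogenisation.LagrangianStep.Sideband

end
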